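import Summits.BirchSwinnertonDyer.BirchSwinnertonDyer.Theorems.QuadraticBranchSignedControlPlusMainConjectureBranchSeams
import Summits.BirchSwinnertonDyer.BirchSwinnertonDyer.Theorems.QuadraticBranchSignedControlEtaTransportPlusOfDecomposition
import HarnessLib

/-!
# Route `QuadraticBranchSignedControl` (rung K8, cell `bsd-potss`): the `η`-SEAM of the even main
# conjecture itself — item 19114 (C1_η, `F`-form, all rows) and its declared residual 19243 (C1_η on
# the non-surjective rows) are EQUIVALENT to Kobayashi's even main conjecture AT `η` stated VERBATIM on
# his object `X⁺(V/K_∞)^η`, granted the descent frame (both directions) and Thm. 1.2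

WHAT. Sibling of `…PlusEtaSeam.lean` (same seat; there: the Eisenstein half, item 19242 ⟺ (E⁺_η)).
The `F`-form crux (C1_η) `QuadraticBranchPlusMainConjectureAt V p` (`Char X⁺(V/F_∞) = Char X⁺(V/ℚ_∞)·
(L_p⁺(V,η,X))`, `F = ℚ(√p*)`; reading flag `Kob03-MC-eta-quadratic-subtower`) versus the PRINTED
statement (§4 p. 8: "For every `η`, we have `Char(X⁺(E/K_∞)^η) = (L_p⁺(E, η, X))`") on cc-typer-6's
`EtaSignedSelmerDualData V κ K₀ ℚ_[p] η γ 1`. The two directions exist separately in the tree — ⟹ per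
pair is seat k8q-c3's `etaTransportPlus_of_decomposition` (p418003; needs the ∃-FORM frame `hdecE`:
SOME admissible quadratic model `(F, V', κF, γF)` with a `Γ`-equivariant
`Φ : Sel⁺(V'/F_∞) ≃ Sel⁺(V/ℚ_∞) × Sel⁺(V/K₀ℚ_∞)^η`), ⟸ is seat k8q-c2 g0's
`plusMainConjectureBranch_of_etaPlusMainConjecture_of_decomposition` /
`quadraticBranchPlusMainConjectureAt_of_etaPlusMainConjecture_of_decomposition` (p419065 §2; needs the
∀-FORM frame `hdecA`: for EVERY admissible model such a `Φ`, and Thm. 1.2) — and this file states the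
EQUIVALENCES, both frames displayed verbatim from their owners:
* `plusMainConjectureBranch_iff_etaMainConjecture_of_frames` — **19114 ⟺ «(C1⁺_η) for every good
  `a_p = 0` curve `V`, `p ≥ 5`»** (right-hand side = the body of the node
  `QuadraticBranchPlusEtaMainConjectureAt`, p427065 review-queued, quantified over `p ≥ 5` and `V`;
  = the plus conjunct of the route's `EtaTransportSigned` with its (C1_η) antecedent dropped);
* `plusMainConjectureNonsurjBranch_iff_etaMainConjecture_nonsurj_of_frames` — **19243 ⟺ the same on
  the twists whose `p`-adic tower is NOT onto** (CM twists — where it is literally Pollack–Rubin's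
  printed remark p. 448 — and non-CM small image).
CONSEQUENCE for the planner (TARGET R90 option (a)): modulo piece (i) (both forms; a model-existence
lemma turns ∀ into ∃) and Thm. 1.2, the `F`-form items 19114 / 19243 and their print-currency
`η`-forms are the SAME items; with the sibling (19242) and p422507 (19241 cite-level) the whole K8
even-MC block can be carried verbatim on Kobayashi's object.

HONEST FRAMING (cell `bsd-potss`, run/shared/lean/pub/bsd-potss/; FULL-BSD rank ≤ 1 programme, HUMAN
RULING D-0036/D-0074): TOOL THEOREMS ONLY — no definition, no named fact minted, no `sorry`, axioms
standard. CONDITIONAL on the displayed frames `hdecA` / `hdecE` (WANTED, not proved here) and on the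
NAMED fact `Kobayashi2003.thm12_signedSelmerDual_finite_torsion` in hypothesis position; the
conjecture-strength statements appear on BOTH sides of `↔` and are asserted for no curve; items 19114
/ 19243 and the route are NOT closed; nothing is booked; `BSD(W, p)` is claimed for no pair; this is
not "finishing BSD". Seat `bsd-potss-k8q-c2` (prover), g2; `--supports stmt-BirchSwinnertonDyer-19114
--as helper`.

References: [Kobayashi2003] Thm. 1.2 (p. 2), Def. 2.1 + Thm. 2.2 (p. 5), §3 (p. 5), §4 Even main
conjecture (p. 8); [PollackRubin2004] Theorem and remark p. 448; [GreenbergLNM1716] §1 (p. 60), §3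
(descent in prime-to-`p` extensions; reading); [Washington1997] §13.2.
-/


set_option autoImplicit false
set_option linter.dupNamespace false

noncomputable section

open scoped Classical

open CongruenceSubgroup Field WeierstrassCurve
open Literature.NumberTheory.EllipticCurves
open Literature.NumberTheory.EllipticCurves.ModularForms
open Literature.NumberTheory.GaloisRepresentations
open Summit.BirchSwinnertonDyer.Rank1Residual.Additive
open Summit.BirchSwinnertonDyer.Rank1Residual.Additive.SignedTwist
open Summit.BirchSwinnertonDyer.BirchSwinnertonDyer.Theses.QuadraticBranchSignedControl

namespace Summit.BirchSwinnertonDyer.BirchSwinnertonDyer.Theorems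

/-! ## Items 19114 / 19243 ⟺ (C1⁺_η) on their rows, granted both frames -/

/-- **Item 19114 `PlusMainConjectureBranch` ((C1_η), `F`-form, all rows) ⟺ «Kobayashi's even main
conjecture AT `η` on the `η`-component object, for every good `a_p = 0` curve `V`, `p ≥ 5`»**, granted
BOTH forms of the descent frame and Thm. 1.2. Right-hand side = the body of the node
`QuadraticBranchPlusEtaMainConjectureAt` (p427065) quantified over `p ≥ 5` and `V` (= the plus
conjunct of the route's `EtaTransportSigned` with its (C1_η) antecedent dropped; §4 p. 8 verbatim with
Thm. 2.2's finite generation and torsion). ⟹ is seat k8q-c3's `etaTransportPlus_of_decomposition`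
(p418003; ∃-frame `hdecE`); ⟸ is g0's `plusMainConjectureBranch_of_etaPlusMainConjecture_of_decomposition`
(p419065 §2; ∀-frame `hdecA`, Thm. 1.2 `h12`). So, modulo piece (i) and Thm. 1.2, the `F`-form crux
and the printed `η`-form are the SAME item. CONDITIONAL; closes nothing.
[cite: Kobayashi2003, Thm. 1.2 (p. 2), Def. 2.1 and Thm. 2.2 (p. 5), §3 (p. 5), §4 Even main conjecture (p. 8)]
[cite: GreenbergLNM1716, §1 (p. 60) and §3 (descent in prime-to-p extensions; reading)] -/
theorem plusMainConjectureBranch_iff_etaMainConjecture_of_frames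
    (h12 : Kobayashi2003.thm12_signedSelmerDual_finite_torsion)
    (hdecA : ∀ (p : ℕ) [Fact p.Prime], 5 ≤ p →
      ∀ (K₀ : Type) [Field K₀] [NumberField K₀] [IsCyclotomicExtension {p} ℚ K₀]
        [(galRange (K := ℚ) K₀).Normal] (ηq : absoluteGaloisGroup ℚ →* ℤˣ),
        (∀ σ ∈ galRange (K := ℚ) K₀, ηq σ = 1) → ηq ≠ 1 →
      ∀ (V : WeierstrassCurve ℚ) [V.IsElliptic] [V.IsGloballyMinimal],
        V.HasGoodReductionAtPrime p → V.frobeniusTrace p = 0 →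
      ∀ (κ : ZpExtension ℚ p) (γ : absoluteGaloisGroup ℚ),
        κ.IsCyclotomic → κ.IsTopGenerator γ → γ ∈ galRange (K := ℚ) K₀ →
        IsCyclotomicVariable p γ →
      ∀ (F : Type) [Field F] [NumberField F] (V' : WeierstrassCurve F) [V'.IsElliptic]
        (κF : ZpExtension F p) (γF : absoluteGaloisGroup F),
        Module.finrank ℚ F = 2 → (∃ θ : F, θ ^ 2 = algebraMap ℚ F ((-1) ^ (p / 2) * p)) →
        (∃ C : VariableChange F, C • V.baseChange F = V') →
        κF.IsCyclotomic → κF.IsTopGenerator γF →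
        (∃ ζ : ℤ_[p]ˣ, IsOfFinOrder ζ ∧
          ((GaloisRep.cyclotomicCharacter F p γF * ζ : ℤ_[p]ˣ) : ℤ_[p]) =
            (cyclotomicGenerator p : ℤ_[p])) →
      ∃ Φ : Kobayashi2003.signedSelmerInfty V' κF 1 ≃+
          Kobayashi2003.signedSelmerInfty V κ 1 × towerSignedSelmerInftyEta V κ K₀ ℚ_[p] ηq 1,
        ∀ s : Kobayashi2003.signedSelmerInfty V' κF 1,
          ((Φ ⟨V'.conjH1 p κF.kerSubgroup γF s,
              Kobayashi2003.conjH1_mem_signedSelmerInfty V' κF 1 γF s.2⟩).1 :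
              V.subgroupH1 p κ.kerSubgroup) =
            V.conjH1 p κ.kerSubgroup γ (Φ s).1 ∧
          ((Φ ⟨V'.conjH1 p κF.kerSubgroup γF s,
              Kobayashi2003.conjH1_mem_signedSelmerInfty V' κF 1 γF s.2⟩).2 :
              V.subgroupH1 p (towerTopSubgroup κ K₀)) =
            V.conjH1 p (towerTopSubgroup κ K₀) γ (Φ s).2)
    (hdecE : ∀ (p : ℕ) [Fact p.Prime], 5 ≤ p →
      ∀ (K₀ : Type) [Field K₀] [NumberField K₀] [IsCyclotomicExtension {p} ℚ K₀]
        [(galRange (K := ℚ) K₀).Normal] (ηq : absoluteGaloisGroup ℚ →* ℤˣ),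
        (∀ σ ∈ galRange (K := ℚ) K₀, ηq σ = 1) → ηq ≠ 1 →
      ∀ (V : WeierstrassCurve ℚ) [V.IsElliptic] [V.IsGloballyMinimal],
        V.HasGoodReductionAtPrime p → V.frobeniusTrace p = 0 →
      ∀ (κ : ZpExtension ℚ p) (γ : absoluteGaloisGroup ℚ),
        κ.IsCyclotomic → κ.IsTopGenerator γ → γ ∈ galRange (K := ℚ) K₀ →
        IsCyclotomicVariable p γ →
      ∃ (F : Type) (_ : Field F) (_ : NumberField F) (V' : WeierstrassCurve F) (_ : V'.IsElliptic)
        (κF : ZpExtension F p) (γF : absoluteGaloisGroup F)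
        (Φ : Kobayashi2003.signedSelmerInfty V' κF 1 ≃+
          Kobayashi2003.signedSelmerInfty V κ 1 × towerSignedSelmerInftyEta V κ K₀ ℚ_[p] ηq 1),
        Module.finrank ℚ F = 2 ∧ (∃ θ : F, θ ^ 2 = algebraMap ℚ F ((-1) ^ (p / 2) * p)) ∧
        (∃ C : VariableChange F, C • V.baseChange F = V') ∧
        κF.IsCyclotomic ∧ κF.IsTopGenerator γF ∧
        (∃ ζ : ℤ_[p]ˣ, IsOfFinOrder ζ ∧
          ((GaloisRep.cyclotomicCharacter F p γF * ζ : ℤ_[p]ˣ) : ℤ_[p]) =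
            (cyclotomicGenerator p : ℤ_[p])) ∧
        ∀ s : Kobayashi2003.signedSelmerInfty V' κF 1,
          ((Φ ⟨V'.conjH1 p κF.kerSubgroup γF s,
              Kobayashi2003.conjH1_mem_signedSelmerInfty V' κF 1 γF s.2⟩).1 :
              V.subgroupH1 p κ.kerSubgroup) =
            V.conjH1 p κ.kerSubgroup γ (Φ s).1 ∧
          ((Φ ⟨V'.conjH1 p κF.kerSubgroup γF s,
              Kobayashi2003.conjH1_mem_signedSelmerInfty V' κF 1 γF s.2⟩).2 :
              V.subgroupH1 p (towerTopSubgroup κ K₀)) =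
            V.conjH1 p (towerTopSubgroup κ K₀) γ (Φ s).2) :
    PlusMainConjectureBranch ↔
      ∀ (p : ℕ) [Fact p.Prime], 5 ≤ p →
      ∀ (K₀ : Type) [Field K₀] [NumberField K₀] [IsCyclotomicExtension {p} ℚ K₀]
        [(galRange (K := ℚ) K₀).Normal] (ηq : absoluteGaloisGroup ℚ →* ℤˣ),
        (∀ σ ∈ galRange (K := ℚ) K₀, ηq σ = 1) → ηq ≠ 1 →
      ∀ (V : WeierstrassCurve ℚ) [V.IsElliptic] [V.IsGloballyMinimal] {N : ℕ} [NeZero N]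
        {f : CuspForm (Gamma0 N) 2},
        p ≠ 2 → V.HasGoodReductionAtPrime p → V.frobeniusTrace p = 0 → IsNewformOf V f →
      ∀ (ϖ : ℚ), (if Even (p / 2) then (ϖ : ℝ) * V.realPeriodRat = plusPeriod f
          else (ϖ : ℝ) * V.imaginaryPeriodRat = minusPeriod f) →
      ∀ (Lη : IwasawaAlgebra p), IsQuadraticBranchPlusLFunction f p ϖ Lη →
      ∀ (κ : ZpExtension ℚ p) (γ : absoluteGaloisGroup ℚ),
        κ.IsCyclotomic → κ.IsTopGenerator γ → γ ∈ galRange (K := ℚ) K₀ →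
        IsCyclotomicVariable p γ →
      ∀ (D : EtaSignedSelmerDualData V κ K₀ ℚ_[p] ηq γ 1),
        Module.Finite (IwasawaAlgebra p) D.X ∧ Module.IsTorsion (IwasawaAlgebra p) D.X ∧
          D.charIdeal = Ideal.span {Lη} := by
  constructor
  · intro h p _ hp5 K₀ _ _ _ _ ηq hηK hη1 V _ _ N _ f hp2 hgood hap hf ϖ hϖ Lη hL κ γ hκ hγ hγK hγc D
    exact etaTransportPlus_of_decomposition hdecE p hp5 K₀ ηq hηK hη1 V hp2 hgood hap
      (h V p hp5 hgood hap) hf ϖ hϖ Lη hL κ γ hκ hγ hγK hγc D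
  · intro h
    exact plusMainConjectureBranch_of_etaPlusMainConjecture_of_decomposition h12 hdecA h

/-- **Item 19243 `PlusMainConjectureNonsurjBranch` (the declared residual: (C1_η) on the twists whose
`p`-adic tower is NOT onto — CM twists, non-CM small image) ⟺ «Kobayashi's even main conjecture AT
`η` on the `η`-component object, for every good `a_p = 0` curve `V`, `p ≥ 5`, with `ρ_{V,p^m}` not
onto for some `m`»**, granted both frames and Thm. 1.2 — the residual, too, can be carried VERBATIM in
print currency (where, for CM `V`, it is literally the statement of Pollack–Rubin's remark p. 448).
⟹ per pair by k8q-c3's `etaTransportPlus_of_decomposition`; ⟸ per pair by g0's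
`quadraticBranchPlusMainConjectureAt_of_etaPlusMainConjecture_of_decomposition` at `K₀ = ℚ(ζ_p)`.
CONDITIONAL; closes nothing.
[cite: Kobayashi2003, Thm. 1.2 (p. 2), §4 Even main conjecture (p. 8), §3 (p. 5)]
[cite: PollackRubin2004, Theorem and remark p. 448 (CM case; remark only)] -/
theorem plusMainConjectureNonsurjBranch_iff_etaMainConjecture_nonsurj_of_frames
    (h12 : Kobayashi2003.thm12_signedSelmerDual_finite_torsion)
    (hdecA : ∀ (p : ℕ) [Fact p.Prime], 5 ≤ p →
      ∀ (K₀ : Type) [Field K₀] [NumberField K₀] [IsCyclotomicExtension {p} ℚ K₀]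
        [(galRange (K := ℚ) K₀).Normal] (ηq : absoluteGaloisGroup ℚ →* ℤˣ),
        (∀ σ ∈ galRange (K := ℚ) K₀, ηq σ = 1) → ηq ≠ 1 →
      ∀ (V : WeierstrassCurve ℚ) [V.IsElliptic] [V.IsGloballyMinimal],
        V.HasGoodReductionAtPrime p → V.frobeniusTrace p = 0 →
      ∀ (κ : ZpExtension ℚ p) (γ : absoluteGaloisGroup ℚ),
        κ.IsCyclotomic → κ.IsTopGenerator γ → γ ∈ galRange (K := ℚ) K₀ →
        IsCyclotomicVariable p γ →
      ∀ (F : Type) [Field F] [NumberField F] (V' : WeierstrassCurve F) [V'.IsElliptic]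
        (κF : ZpExtension F p) (γF : absoluteGaloisGroup F),
        Module.finrank ℚ F = 2 → (∃ θ : F, θ ^ 2 = algebraMap ℚ F ((-1) ^ (p / 2) * p)) →
        (∃ C : VariableChange F, C • V.baseChange F = V') →
        κF.IsCyclotomic → κF.IsTopGenerator γF →
        (∃ ζ : ℤ_[p]ˣ, IsOfFinOrder ζ ∧
          ((GaloisRep.cyclotomicCharacter F p γF * ζ : ℤ_[p]ˣ) : ℤ_[p]) =
            (cyclotomicGenerator p : ℤ_[p])) →
      ∃ Φ : Kobayashi2003.signedSelmerInfty V' κF 1 ≃+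
          Kobayashi2003.signedSelmerInfty V κ 1 × towerSignedSelmerInftyEta V κ K₀ ℚ_[p] ηq 1,
        ∀ s : Kobayashi2003.signedSelmerInfty V' κF 1,
          ((Φ ⟨V'.conjH1 p κF.kerSubgroup γF s,
              Kobayashi2003.conjH1_mem_signedSelmerInfty V' κF 1 γF s.2⟩).1 :
              V.subgroupH1 p κ.kerSubgroup) =
            V.conjH1 p κ.kerSubgroup γ (Φ s).1 ∧
          ((Φ ⟨V'.conjH1 p κF.kerSubgroup γF s,
              Kobayashi2003.conjH1_mem_signedSelmerInfty V' κF 1 γF s.2⟩).2 :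
              V.subgroupH1 p (towerTopSubgroup κ K₀)) =
            V.conjH1 p (towerTopSubgroup κ K₀) γ (Φ s).2)
    (hdecE : ∀ (p : ℕ) [Fact p.Prime], 5 ≤ p →
      ∀ (K₀ : Type) [Field K₀] [NumberField K₀] [IsCyclotomicExtension {p} ℚ K₀]
        [(galRange (K := ℚ) K₀).Normal] (ηq : absoluteGaloisGroup ℚ →* ℤˣ),
        (∀ σ ∈ galRange (K := ℚ) K₀, ηq σ = 1) → ηq ≠ 1 →
      ∀ (V : WeierstrassCurve ℚ) [V.IsElliptic] [V.IsGloballyMinimal],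
        V.HasGoodReductionAtPrime p → V.frobeniusTrace p = 0 →
      ∀ (κ : ZpExtension ℚ p) (γ : absoluteGaloisGroup ℚ),
        κ.IsCyclotomic → κ.IsTopGenerator γ → γ ∈ galRange (K := ℚ) K₀ →
        IsCyclotomicVariable p γ →
      ∃ (F : Type) (_ : Field F) (_ : NumberField F) (V' : WeierstrassCurve F) (_ : V'.IsElliptic)
        (κF : ZpExtension F p) (γF : absoluteGaloisGroup F)
        (Φ : Kobayashi2003.signedSelmerInfty V' κF 1 ≃+
          Kobayashi2003.signedSelmerInfty V κ 1 × towerSignedSelmerInftyEta V κ K₀ ℚ_[p] ηq 1),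
        Module.finrank ℚ F = 2 ∧ (∃ θ : F, θ ^ 2 = algebraMap ℚ F ((-1) ^ (p / 2) * p)) ∧
        (∃ C : VariableChange F, C • V.baseChange F = V') ∧
        κF.IsCyclotomic ∧ κF.IsTopGenerator γF ∧
        (∃ ζ : ℤ_[p]ˣ, IsOfFinOrder ζ ∧
          ((GaloisRep.cyclotomicCharacter F p γF * ζ : ℤ_[p]ˣ) : ℤ_[p]) =
            (cyclotomicGenerator p : ℤ_[p])) ∧
        ∀ s : Kobayashi2003.signedSelmerInfty V' κF 1,
          ((Φ ⟨V'.conjH1 p κF.kerSubgroup γF s,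
              Kobayashi2003.conjH1_mem_signedSelmerInfty V' κF 1 γF s.2⟩).1 :
              V.subgroupH1 p κ.kerSubgroup) =
            V.conjH1 p κ.kerSubgroup γ (Φ s).1 ∧
          ((Φ ⟨V'.conjH1 p κF.kerSubgroup γF s,
              Kobayashi2003.conjH1_mem_signedSelmerInfty V' κF 1 γF s.2⟩).2 :
              V.subgroupH1 p (towerTopSubgroup κ K₀)) =
            V.conjH1 p (towerTopSubgroup κ K₀) γ (Φ s).2) :
    PlusMainConjectureNonsurjBranch ↔
      ∀ (p : ℕ) [Fact p.Prime], 5 ≤ p →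
      ∀ (K₀ : Type) [Field K₀] [NumberField K₀] [IsCyclotomicExtension {p} ℚ K₀]
        [(galRange (K := ℚ) K₀).Normal] (ηq : absoluteGaloisGroup ℚ →* ℤˣ),
        (∀ σ ∈ galRange (K := ℚ) K₀, ηq σ = 1) → ηq ≠ 1 →
      ∀ (V : WeierstrassCurve ℚ) [V.IsElliptic] [V.IsGloballyMinimal] {N : ℕ} [NeZero N]
        {f : CuspForm (Gamma0 N) 2},
        p ≠ 2 → V.HasGoodReductionAtPrime p → V.frobeniusTrace p = 0 →
        ¬ (∀ m : ℕ, V.HasSurjectiveModNGaloisRep (p ^ m : ℕ)) → IsNewformOf V f →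
      ∀ (ϖ : ℚ), (if Even (p / 2) then (ϖ : ℝ) * V.realPeriodRat = plusPeriod f
          else (ϖ : ℝ) * V.imaginaryPeriodRat = minusPeriod f) →
      ∀ (Lη : IwasawaAlgebra p), IsQuadraticBranchPlusLFunction f p ϖ Lη →
      ∀ (κ : ZpExtension ℚ p) (γ : absoluteGaloisGroup ℚ),
        κ.IsCyclotomic → κ.IsTopGenerator γ → γ ∈ galRange (K := ℚ) K₀ →
        IsCyclotomicVariable p γ →
      ∀ (D : EtaSignedSelmerDualData V κ K₀ ℚ_[p] ηq γ 1),
        Module.Finite (IwasawaAlgebra p) D.X ∧ Module.IsTorsion (IwasawaAlgebra p) D.X ∧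
          D.charIdeal = Ideal.span {Lη} := by
  constructor
  · intro h p _ hp5 K₀ _ _ _ _ ηq hηK hη1 V _ _ N _ f hp2 hgood hap hns hf ϖ hϖ Lη hL κ γ hκ hγ hγK
      hγc D
    exact etaTransportPlus_of_decomposition hdecE p hp5 K₀ ηq hηK hη1 V hp2 hgood hap
      (h V p hp5 hgood hap hns) hf ϖ hϖ Lη hL κ γ hκ hγ hγK hγc D
  · intro h V _ _ p _ hp5 hgood hap hns
    have hp2 : p ≠ 2 := by omega
    haveI : NeZero p := ⟨(Fact.out : p.Prime).ne_zero⟩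
    haveI : IsCyclotomicExtension {p} ℚ (CyclotomicField p ℚ) :=
      CyclotomicField.isCyclotomicExtension p ℚ
    haveI : (galRange (K := ℚ) (CyclotomicField p ℚ)).Normal := normal_galRange_cyclotomic p _
    obtain ⟨θ, ηq, -, -, -, hηK, hη1⟩ := exists_theta_eta_cyclotomicField p hp2
    exact quadraticBranchPlusMainConjectureAt_of_etaPlusMainConjecture_of_decomposition h12
      (CyclotomicField p ℚ) ηq
      (fun κ γ hκ hγ hγK hγc F _ _ V' _ κF γF hF hθ hC hκF hγF hζ =>
        hdecA p hp5 (CyclotomicField p ℚ) ηq hηK hη1 V hgood hap κ γ hκ hγ hγK hγc F V' κF γF hF hθ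
          hC hκF hγF hζ)
      (fun hp2' hgood' hap' hf ϖ hϖ Lη hL κ γ hκ hγ hγK hγc D =>
        h p hp5 (CyclotomicField p ℚ) ηq hηK hη1 V hp2' hgood' hap' hns hf ϖ hϖ Lη hL κ γ hκ hγ hγK
          hγc D)

end Summit.BirchSwinnertonDyer.BirchSwinnertonDyer.Theorems

end
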